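import Mathlib
import HarnessLib
import Literature.Analysis.FluidPDE.TypeIAncientMild
import Literature.Analysis.FluidPDE.VorticityCalculus
import Literature.Analysis.FluidPDE.NSVorticityBKMProofs
import Summits.NavierStokesRegularity.NavierStokesRegularity.Theorems.ClockStretchingLawSmallStrainRung
import Summits.NavierStokesRegularity.NavierStokesRegularity.Theorems.IsobarTomographyBlobRiccatiClosureTypeIGaugeBounds
import Summits.NavierStokesRegularity.NavierStokesRegularity.Theorems.IsobarTomographyBlobRiccatiClosureDivCurlGradientBound

/-!
# Crux `IsobarTomography.BlobRiccatiClosure` (stmt-NavierStokesRegularity-11740), line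
# `type-i-apex-liouville` — Liouville for Type-I ancient mild fields with small scaled vorticity

Helper file (theorems only) `--supports` the item (registered stub
`stub_smallScaledVorticityLiouville`, the last theorem). The residual C of the line
(`stub_apexAntiBlob`) lives on the apexes `(σ, 0)` of Type-I ancient mild fields (global space–time
maximisers of the scale-invariant vorticity `(−s)‖curl W(s, y)‖`, normalised to `‖curl W(σ,0)‖ = 1`,
so that `G = −σ` is the scaled vorticity maximum). This file proves that `G` cannot be small:

**Theorem (`stub_smallScaledVorticityLiouville`).** For every `C` there is `ε(C) > 0` such that a
Type-I ancient mild field `W` (KNSS/Oseen gauge, constant `C`) with `(−t)‖curl W(t, x)‖ ≤ ε` for all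
`t < 0`, `x` vanishes identically.

Proof. The local div–curl tomography of the velocity gradient (`stub_divCurlGradientBound`,
previous file) applied to a slice `W(t)` at radius `R = M√(−t)`, with the Type-I bound
`|W| ≤ C/√(−t)`, the class-uniform gauge bounds `(−t)‖∇W‖ ≤ K₁(C)`, `(−t)^{3/2}‖D²W‖ ≤ K₂(C)`
(`stub_typeIGaugeBounds`, KNSS 2009 Prop. 4.1 transported by scaling; the second gives the
Lipschitz constant `4K₂(−t)^{-3/2}` of `curl W(t)`) and the smallness of the vorticity, gives
`(−t)‖∇W(t, x)‖ ≤ c₀(ε + C/M + 2√(MεK₂) + √(CK₁/M))` (`smallVorticity_scale_identity`), which is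
`≤ ½` once `M` is large and then `ε` small (`smallVorticity_exists_scales`). The gauge strain bound
`(−t)‖∇W(t)‖ ≤ ½` is exactly the hypothesis of the proved small-strain rung of route
`ClockStretchingLaw` (`clockStretchingLaw_smallStrainRung_proof`: the constant stretching
certificate kills the vorticity by the weighted vorticity maximum principle, bounded curl- and
divergence-free slices are constant, and the KNSS gauge kills slice-constants), so `W ≡ 0`.

Not here: the apex corollaries (next file, `…ApexScaleFloor`).

## References

* G. Koch, N. Nadirashvili, G. Seregin, V. Šverák, *Liouville theorems for the Navier–Stokes
  equations and applications*, Acta Math. 203 (2009) = arXiv:0709.3599, Prop. 4.1 (4.10),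
  Lemma 3.1, Remark 6.1. [KochNadirashviliSereginSverak2009]
* A. J. Majda, A. L. Bertozzi, *Vorticity and Incompressible Flow* (CUP 2002), §4.1.3 (4.39). [MajdaBertozziCUP2002]
-/

noncomputable section

open Set Filter Topology Function MeasureTheory Metric
open scoped RealInnerProductSpace NNReal

-- the summit and its single sub-problem share the name (CONVENTIONS §1), as in every Theorems file
set_option linter.dupNamespace false

namespace Summit.NavierStokesRegularity.NavierStokesRegularity.Theorems.BlobRiccatiClosure.TypeIApexLiouville

open Literature.Analysis Literature.Analysis.FluidPDE
open Summit.NavierStokesRegularity.NavierStokesRegularity.Theorems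

/-! ### Scale bookkeeping -/

/-- The four scale-homogeneous quantities of the div–curl tomography evaluated on a Type-I
slice: with `s = −t > 0`, `A = C/√s`, `A₁ = K₁/s`, `B = ε/s`, `B₁ = 4K₂/(s√s)`, `R = M√s`,

  `B + A/R + √(R B B₁) + √(A A₁/R) = (ε + C/M + 2√(M ε K₂) + √(C K₁/M)) / s`. [folklore] -/
theorem smallVorticity_scale_identity (C K₁ K₂ ε : ℝ) {M s : ℝ} (hM : 0 < M) (hs : 0 < s) :
    ε / s + C / Real.sqrt s / (M * Real.sqrt s) +
        Real.sqrt (M * Real.sqrt s * (ε / s) * (4 * K₂ / (s * Real.sqrt s))) +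
        Real.sqrt (C / Real.sqrt s * (K₁ / s) / (M * Real.sqrt s)) =
      (ε + C / M + 2 * Real.sqrt (M * ε * K₂) + Real.sqrt (C * K₁ / M)) / s := by
  have hr : 0 < Real.sqrt s := Real.sqrt_pos.2 hs
  have hr2 : Real.sqrt s ^ 2 = s := Real.sq_sqrt hs.le
  have e1 : C / Real.sqrt s / (M * Real.sqrt s) = C / M / s := by
    field_simp
    rw [hr2]
  have e2 : M * Real.sqrt s * (ε / s) * (4 * K₂ / (s * Real.sqrt s)) = 2 ^ 2 * ((M * ε * K₂) / s ^ 2) := by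
    field_simp
    ring
  have e3 : C / Real.sqrt s * (K₁ / s) / (M * Real.sqrt s) = (C * K₁ / M) / s ^ 2 := by
    field_simp
    rw [hr2]
    ring
  rw [e1, e2, e3, Real.sqrt_mul (by norm_num : (0 : ℝ) ≤ 2 ^ 2), Real.sqrt_sq (by norm_num : (0:ℝ) ≤ 2),
    Real.sqrt_div' _ (by positivity : (0 : ℝ) ≤ s ^ 2), Real.sqrt_div' _ (by positivity : (0 : ℝ) ≤ s ^ 2),
    Real.sqrt_sq hs.le]
  field_simp

/-- **Choice of the scales.** Given `c₀ > 0` and `C, K₁, K₂ ≥ 0` there are `M > 0` and `ε > 0`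
with `c₀ (ε + C/M + 2√(MεK₂) + √(CK₁/M)) ≤ 1/2` (first `M` large, then `ε` small). [folklore] -/
theorem smallVorticity_exists_scales {c₀ C K₁ K₂ : ℝ} (hc₀ : 0 < c₀) (hC : 0 ≤ C) (hK₁ : 0 ≤ K₁)
    (hK₂ : 0 ≤ K₂) :
    ∃ M ε : ℝ, 0 < M ∧ 0 < ε ∧
      c₀ * (ε + C / M + 2 * Real.sqrt (M * ε * K₂) + Real.sqrt (C * K₁ / M)) ≤ 1 / 2 := by
  -- `M` large: `c₀ C / M ≤ 1/8` and `c₀ √(C K₁ / M) ≤ 1/8`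
  set M : ℝ := 8 * c₀ * (C + 1) + 64 * c₀ ^ 2 * (C + 1) * (K₁ + 1) with hM
  have hM0 : 0 < M := by positivity
  have hq1 : 0 ≤ 64 * c₀ ^ 2 * (C + 1) * (K₁ + 1) := by positivity
  have hq2 : 0 ≤ 64 * c₀ ^ 2 * C := by positivity
  have hq3 : 0 ≤ 64 * c₀ ^ 2 * K₁ := by positivity
  have hq4 : 0 ≤ 64 * c₀ ^ 2 := by positivity
  have hM1 : 8 * c₀ * C ≤ M := by rw [hM]; nlinarith
  have hM2 : 64 * c₀ ^ 2 * (C * K₁) ≤ M := by rw [hM]; nlinarith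
  -- `ε` small: `c₀ ε ≤ 1/8` and `2 c₀ √(M ε K₂) ≤ 1/8`
  set ε : ℝ := 1 / (8 * c₀ + 256 * c₀ ^ 2 * M * (K₂ + 1)) with hε
  have hden : 0 < 8 * c₀ + 256 * c₀ ^ 2 * M * (K₂ + 1) := by positivity
  have hε0 : 0 < ε := by positivity
  have hε1 : c₀ * ε ≤ 1 / 8 := by
    rw [hε, mul_one_div, div_le_div_iff₀ hden (by norm_num : (0:ℝ) < 8)]
    nlinarith [sq_nonneg c₀, mul_nonneg (mul_nonneg (sq_nonneg c₀) hM0.le) hK₂]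
  have hε2 : 256 * c₀ ^ 2 * (M * ε * K₂) ≤ 1 := by
    have : M * ε * K₂ = (M * K₂) * ε := by ring
    rw [this, hε, ← mul_assoc, mul_one_div, div_le_one hden]
    nlinarith [sq_nonneg c₀, mul_nonneg (mul_nonneg (sq_nonneg c₀) hM0.le) hK₂, hc₀]
  refine ⟨M, ε, hM0, hε0, ?_⟩
  -- the two square roots
  have hs1 : c₀ * Real.sqrt (C * K₁ / M) ≤ 1 / 8 := by
    have h1 : C * K₁ / M ≤ (1 / (8 * c₀)) ^ 2 := by
      rw [div_le_iff₀ hM0, div_pow, one_pow, div_mul_eq_mul_div, le_div_iff₀ (by positivity)]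
      nlinarith
    calc c₀ * Real.sqrt (C * K₁ / M) ≤ c₀ * Real.sqrt ((1 / (8 * c₀)) ^ 2) := by
          gcongr
      _ = 1 / 8 := by rw [Real.sqrt_sq (by positivity)]; field_simp
  have hs2 : 2 * c₀ * Real.sqrt (M * ε * K₂) ≤ 1 / 8 := by
    have h1 : M * ε * K₂ ≤ (1 / (16 * c₀)) ^ 2 := by
      rw [div_pow, one_pow, le_div_iff₀ (by positivity)]
      nlinarith
    calc 2 * c₀ * Real.sqrt (M * ε * K₂) ≤ 2 * c₀ * Real.sqrt ((1 / (16 * c₀)) ^ 2) := by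
          gcongr
      _ = 1 / 8 := by rw [Real.sqrt_sq (by positivity)]; field_simp; norm_num
  have hs3 : c₀ * (C / M) ≤ 1 / 8 := by
    rw [mul_div_assoc', div_le_iff₀ hM0]
    linarith
  nlinarith [hε1, hs1, hs2, hs3]

/-! ### The Liouville theorem -/

/-- **Liouville for Type-I ancient mild fields with small scaled vorticity (registered stub
`stub_smallScaledVorticityLiouville`).** For every Type-I constant `C` there is `ε = ε(C) > 0`
such that every Type-I ancient mild Navier–Stokes field `W` (KNSS/Oseen gauge) whose
scale-invariant vorticity is `ε`-small, `(−t)‖curl W(t, x)‖ ≤ ε` for all `t < 0`, `x`, vanishes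
identically.

Proof. At a point `(t, x)` apply the div–curl tomography of the velocity gradient
(`stub_divCurlGradientBound`) to the slice `W(t)` at radius `R = M√(−t)` with the Type-I
velocity bound `C/√(−t)`, the class-uniform gauge bounds `(−t)‖∇W‖ ≤ K₁`,
`(−t)^{3/2}‖D²W‖ ≤ K₂` (`stub_typeIGaugeBounds`, giving the `4K₂(−t)^{-3/2}`-Lipschitz bound of
`curl W(t)`) and the smallness of the vorticity: `(−t)‖∇W(t,x)‖ ≤ c₀(ε + C/M + 2√(MεK₂) + √(CK₁/M))`,
which is `≤ ½` for `M = M(c₀, C, K₁)` large and `ε = ε(c₀, C, K₁, K₂, M)` small. The strain gauge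
bound `(−t)‖∇W(t)‖ ≤ ½` is the hypothesis of the proved small-strain rung
(`clockStretchingLaw_smallStrainRung_proof`: the constant stretching certificate kills the
vorticity, bounded curl- and divergence-free slices are constant, and the KNSS gauge kills
slice-constants), so `W ≡ 0`. [cite: KochNadirashviliSereginSverak2009, Prop. 4.1 (4.10), Lemma 3.1, Remark 6.1 (arXiv:0709.3599); MajdaBertozziCUP2002, §4.1.3 (4.39)] -/
theorem stub_smallScaledVorticityLiouville : ∀ C : ℝ, ∃ ε : ℝ, 0 < ε ∧ ∀ (W : ℝ → EuclideanSpace ℝ (Fin 3) → EuclideanSpace ℝ (Fin 3)), IsTypeIAncientMild C W → (∀ t < 0, ∀ x, (-t) * ‖curl (W t) x‖ ≤ ε) → ∀ t < 0, ∀ x, W t x = 0 := by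
  intro C
  obtain ⟨c₀, hc₀, hT⟩ := stub_divCurlGradientBound
  obtain ⟨K₁, K₂, hK₁, hK₂, hG⟩ := stub_typeIGaugeBounds C
  -- the constants do not see `W`; use `C⁺ = max C 0`
  obtain ⟨M, ε, hM, hε, hsmall⟩ :=
    smallVorticity_exists_scales hc₀ (le_max_right C 0) hK₁ hK₂
  refine ⟨ε, hε, fun W hW hω t ht x => ?_⟩
  have hCnn : 0 ≤ C := hW.nonneg
  have hCmax : max C 0 = C := max_eq_left hCnn
  rw [hCmax] at hsmall
  -- the gauge strain bound `(−t)‖∇W(t)‖ ≤ 1/2` at every point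
  have hstrain : ∀ t < 0, ∀ x, ‖fderiv ℝ (W t) x‖ ≤ (1 / 2) / (-t) := by
    intro t ht x
    have hs : 0 < -t := neg_pos.2 ht
    have hr : 0 < Real.sqrt (-t) := Real.sqrt_pos.2 hs
    have hsl : ContDiff ℝ 3 (W t) := (hW.contDiff_slice ht).of_le (by norm_cast)
    have hsl2 : ContDiff ℝ 2 (W t) := (hW.contDiff_slice ht).of_le (by norm_cast)
    -- the data of the tomography
    have hA : ∀ y, ‖W t y‖ ≤ C / Real.sqrt (-t) := fun y => hW.norm_le ht y
    have hA₁ : ∀ y, ‖fderiv ℝ (W t) y‖ ≤ K₁ / (-t) := fun y => by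
      have h1 := (hG W hW t ht y).1
      rw [le_div_iff₀ hs]; linarith
    have hB : ∀ y, ‖curl (W t) y‖ ≤ ε / (-t) := fun y => by
      have h1 := hω t ht y
      rw [le_div_iff₀ hs]; linarith
    have hD2 : ∀ y, ‖fderiv ℝ (fderiv ℝ (W t)) y‖ ≤ K₂ / ((-t) * Real.sqrt (-t)) := fun y => by
      have h1 := (hG W hW t ht y).2
      have hpos : 0 < (-t) * Real.sqrt (-t) := by positivity
      rw [← norm_iteratedFDeriv_one (fderiv ℝ (W t)), norm_iteratedFDeriv_fderiv, le_div_iff₀ hpos]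
      linarith
    have hB₁ : ∀ y y', ‖curl (W t) y - curl (W t) y'‖ ≤ 4 * K₂ / ((-t) * Real.sqrt (-t)) * ‖y - y'‖ := by
      intro y y'
      have hdd : Differentiable ℝ (fderiv ℝ (W t)) :=
        (hsl2.fderiv_right (m := 1) (by norm_num)).differentiable one_ne_zero
      have hmv : ‖fderiv ℝ (W t) y - fderiv ℝ (W t) y'‖ ≤ K₂ / ((-t) * Real.sqrt (-t)) * ‖y - y'‖ := by
        rw [← norm_neg, neg_sub, ← norm_neg (y - y'), neg_sub]
        exact Convex.norm_image_sub_le_of_norm_fderiv_le (fun z _ => hdd z) (fun z _ => hD2 z)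
          convex_univ (mem_univ y) (mem_univ y')
      calc ‖curl (W t) y - curl (W t) y'‖ = ‖curlCLM (fderiv ℝ (W t) y - fderiv ℝ (W t) y')‖ := by
            rw [curl_eq_curlCLM, curl_eq_curlCLM, map_sub]
        _ ≤ ‖curlCLM‖ * ‖fderiv ℝ (W t) y - fderiv ℝ (W t) y'‖ := curlCLM.le_opNorm _
        _ ≤ 4 * (K₂ / ((-t) * Real.sqrt (-t)) * ‖y - y'‖) :=
            mul_le_mul norm_curlCLM_le_four hmv (norm_nonneg _) (by norm_num)
        _ = _ := by ring
    have key := hT (W t) (C / Real.sqrt (-t)) (K₁ / (-t)) (ε / (-t))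
      (4 * K₂ / ((-t) * Real.sqrt (-t))) (M * Real.sqrt (-t)) x hsl (hW.isDivFree ht) hA hA₁ hB hB₁
      (by positivity) (by positivity) (by positivity) (by positivity) (by positivity)
    rw [smallVorticity_scale_identity C K₁ K₂ ε hM hs] at key
    calc ‖fderiv ℝ (W t) x‖ ≤ _ := key
      _ = c₀ * (ε + C / M + 2 * Real.sqrt (M * ε * K₂) + Real.sqrt (C * K₁ / M)) / (-t) := by ring
      _ ≤ (1 / 2) / (-t) := div_le_div_of_nonneg_right hsmall hs.le
  exact clockStretchingLaw_smallStrainRung_proof C W (isTypeIAncientMild_iff.1 hW) hstrain t ht x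

end Summit.NavierStokesRegularity.NavierStokesRegularity.Theorems.BlobRiccatiClosure.TypeIApexLiouville

end
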